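import Summits.CriticalPhenomena.PercolationContinuityZ3.Theses.PercNearOneGluing
import Literature.Probability.Percolation.PercolationEvents
import HarnessLib.Audit

/-! TTRL-lite variant V2431 of stmt-CriticalPhenomena-4574

(`stub_shorteningStep` of line `kn_shortening_induction`, move `small_case+small_case`:
`n ≤ 3` and `A.card = 4`).  The side conditions are jointly contradictory: a finset
`A : Finset (Fin n)` satisfies `A.card ≤ Fintype.card (Fin n) = n ≤ 3 < 4 = A.card`.
So the statement holds vacuously (compare the sibling variants V2523, `n ≤ 3 ∧ A.card = 3`,
and V2374, `n ≤ 3` alone).  No new definitions, no named facts, the induction hypothesis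
is not used. -/

namespace Summit.CriticalPhenomena.PercolationContinuityZ3.Theorems

open MeasureTheory Set Literature.Probability.LatticeModels Literature.Probability.Percolation
open scoped Classical BigOperators

/-- TTRL-lite variant V2431 of `stub_shorteningStep` (stmt-CriticalPhenomena-4574, Kozma–Nitzan
shortening step with the induction hypothesis displayed): the inequality
`μ(⋃ a ∈ A, v ↔ a) · μ(a₀ ↔ b) ≤ μ(v ↔ b)` for the glued measure `μ = prodBernoulli (w[s(v,x) ↦ 1])`
in the small case `A.card = 4`, `n ≤ 3`.  Vacuous: `A.card ≤ n ≤ 3 < 4 = A.card`. -/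
theorem stub_shorteningStep_var2431 : ∀ (n : ℕ) (w : Sym2 (Fin n) → unitInterval) (A : Finset (Fin n)) (b v x a₀ : Fin n), A.card = 4 → n ≤ 3 → v ∉ A → v ≠ x → w s(v, x) = 0 → a₀ ∈ A → (∀ a ∈ A, (prodBernoulli w).real (openConn a₀ b) ≤ (prodBernoulli w).real (openConn a b)) → (∀ w' : Sym2 (Fin n) → unitInterval, (∀ e, w e = 0 → w' e = 0) → ∀ (A' : Finset (Fin n)) (o' b' : Fin n) (t : ℝ), (∀ a ∈ A', t ≤ (prodBernoulli w').real (openConn a b')) → (prodBernoulli w').real (⋃ a ∈ A', openConn o' a) * t ≤ (prodBernoulli w').real (openConn o' b')) → (prodBernoulli (Function.update w s(v, x) 1)).real (⋃ a ∈ A, openConn v a) * (prodBernoulli (Function.update w s(v, x) 1)).real (openConn a₀ b) ≤ (prodBernoulli (Function.update w s(v, x) 1)).real (openConn v b) := by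
  intro n w A b v x a₀ hcard hn
  -- `A ⊆ Fin n` has at most `n ≤ 3` elements but exactly `4`: contradiction
  have hle : A.card ≤ Fintype.card (Fin n) := Finset.card_le_univ A
  rw [Fintype.card_fin] at hle
  omega

end Summit.CriticalPhenomena.PercolationContinuityZ3.Theorems
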